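import Literature.MathematicalPhysics.QuantumFieldTheory.Balaban1983to89.B16SProfile
import Literature.MathematicalPhysics.QuantumFieldTheory.Balaban1983to89.TreeLengthCubeSystem
import Literature.MathematicalPhysics.QuantumFieldTheory.Balaban1983to89.T4JointInsertionProfile
import Literature.MathematicalPhysics.QuantumFieldTheory.Balaban1983to89.T4PersistentHistoryCount

/-!
# `Balaban1983to89.T4EntropyShapeInstances` — THE TYPED ENTROPY SHAPES OF NE7b's COUNTING CLAUSE, INSTANTIATED ON
THE ℤᵈ INDEX MODEL OF THE OPERATION S: the shrinking site bound (pv14's binder `hN`) and the birth-shape entropy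
(this lineage's binder `E_f` / `Σ_b ρ_b ≤ ρ̄`) as THEOREMS with dimension-only constants
(cell `pub-balaban`, node U5c / spine estimate NE7b, COUNT side; self-proposed continuation row T4-U5c.E-NE7b-ENT-K* of
T4-DAG v19 §6 NE7b «What remains NOT PRINTED and unproved is exactly: E2-rel (a), E2-rel (b) (d′-relative), NE7b-rem's
values, and the instantiation of the typed entropy shapes by p.383/p.384» — THIS FILE is the last of the four, the other
three are analytic and NOT touched; unit b2b-balaban-t4-ne7b-p1 gen 4 — the lineage of `T4PersistentHistoryCount` /
`T4PersistenceDictionary`; companion record `t4/T4-EST-NE7b-P1.md` v1.3; imports b02's `B16SProfile`, pv03/pv18's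
`TreeLengthCubeSystem`, pv14's `T4JointInsertionProfile` and this lineage's `T4PersistentHistoryCount`; modifies nothing)

HONEST FRAMING (cell `pub-balaban`, T4-DAG PAGE 1).  The cell's T4 target is the existence AND uniqueness of the
`ε → 0` limit of Bałaban's unit-scale block-averaged expectations on a FIXED finite four-torus — NOT infinite volume, NOT
a mass gap, NOT the Clay problem.  This module is [folklore] finite combinatorics on `ℤᵈ` and real arithmetic (zero
`sorry`, zero cite-tagged hypothesis, no `def … : Prop` fact of Bałaban's); it uses NONE of the cell's conditionals
(BetaPertH, (B), (B^μ)).  B16 = [Balaban1989LargeFieldII] is a manuscript UNDER AUDIT: pp. 383–385 are quoted below for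
what they STATE (read as images on the ×2 renders `b2b-balaban-ref1/pages/1989-cmp122-large-field-II/…-p029/p030/p031-x2.png`,
journal page = render + 354), as the LOCATION of the shapes instantiated here, never as establishing a disputed step.
Value = the entropy constants of an existing typed counting skeleton made kernel theorems of the cell's own geometric
model + located residuals; NOT an estimate of Bałaban's expansion, NOT summit progress.

THE PAGE (LOCATION ONLY).  p. 383 [R p029]: «Finally, the summations over the admissible sequences can be replaced by
the factors exp O(1)(MR_j)^{−d}|Z_j|.» and (1.79) «∏_{j=1}^{k} ∏_i exp(−½γ₀A₁²p₀²(g_j)(d′_j(Z_j^{(i)}) + 1) − 2p₀(g_j))».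
p. 384 [R p030]: «If Z is a union of MR_j-cubes of the lattice T_ξ, ξ = L^{−j}, then we take the cover Z′ of Z by a
smallest union of LMR_{j+1}-cubes, and we add ten layers of such cubes. We denote the obtained domain by S(Z), i.e.,
S(Z) = Z′^{∼10}. Such a domain arises as a new large field region in our procedure, if no large fields are created in a
neighborhood of Z, more precisely in S(Z)\Z. The operation S may be iterated.»; «Denote by Z^{(n−j)} the cover of Z by
MR_n-cubes in the corresponding scale … Thus S^{n−j}(Z) ⊂ ⋃_{□₀⊂Z^{(n−j)}} □₀^{∼31}, and this implies
d′_n(S^{n−j}(Z)) ≤ (63)^d(MR_n)^{−d}|Z^{(n−j)}| ≤ (63)^d 3·2^{d−1}d′_n(Z^{(n−j)}) if the linear size on the right-hand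
side is different from 0, or d′_n(S^{n−j}(Z)) ≤ (64)^d if it is equal to 0. From the scaling property (6.31) [I] we
obtain d′_n(Z^{(n−j)}) ≤ L^{−1/2(n−j)}d′_j(Z) ≤ 2^{−(n−j)}d′_j(Z)» (continued p. 385 [R p031] «for n − j > 1»).

THE INDEX MODEL (b02, `…B16SProfile`, DIVERGENCE D-b02g9.1).  Cubes of the creation scale are points of `ℤᵈ`
(`B13ScaleTransfer.Pt d`); `S_q(X) = collar^[10] (closureCubes q X)` (`Sop`), the iterate `Siter q i` along a ratio
sequence `q`, the accumulated ratio `Qprod q i`, the cover `Z^{(i)} = closureIdx (Qprod q i) Z`, the ratio sequence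
`ratio L σ` of an exponent sequence `σ` (`R_n = L^{σ n}`) and the two-sided DROP CONTROL `DropCtl σ m` (from (2.7b)/(2.9)
[III] by `B16SProfile.dropCtl_of_27b`); `d′ = treeLen` (`…TreeLength`, print's `d′_n` in the units of the step-`n`
cubes).  Everything below is proved over THESE definitions; the volume/tree-length comparison used is the cell's REPAIRED
lower half of (2.30) `TreeLength.card_le_treeLen` (`|Y| ≤ 2^d(4d′(Y) + 1)`, GAPS G-B13-07 / C-pv22-2, DIVERGENCE D-T2),
in place of print's «3·2^{d−1}d′» / «(64)^d» — so the constants are the cell's, dimension-only, not Bałaban's O(1)'s.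

WHAT THIS MODULE PROVES ([folklore]; nothing of Bałaban's asserted):
* §1 THE SHRINKING SITE BOUND.  `zone q r i Z = collar^[r] (Siter q i Z)` (the cubes within `r` layers of the iterate);
  `zone_subset_biUnion_box`: `zone ⊆ ⋃_{c ∈ Z^{(i)}} box c (31 + r)` (`L ≥ 3`, drop control, `i ≤ m`;
  `B16SProfile.Siter_subset_biUnion_box` + layers of boxes); `card_zone_le_cover`: `#zone ≤ (63 + 2r)^d · #Z^{(i)}`;
  `card_cover_le`: `#Z^{(i)} ≤ 2^d(4 d′(Z^{(i)}) + 1)`; `treeLen_cover_le`: `d′(Z^{(i)}) ≤ 2(1/2)^i d′(Z)` for ALL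
  `0 ≤ i ≤ m` (`L ≥ 4`; `B16SProfile.half_pow_mul_treeLen_ge`, the first two steps absorbed in the factor 2); hence
  `card_zone_le`: `#zone ≤ κ_site(d, r) · (1 + d′(Z) · (1/2)^i)` with `κ_site(d, r) = (63 + 2r)^d · 2^{d+3}`
  (`siteConst`), and `card_zone_shift_le` (a region born at step `s`, seen at step `t ≤ K`, absolute drop control on
  `[0, K]`, via `B16SProfile.dropCtl_shift`).
* §2 pv14's SITE HYPOTHESIS DISCHARGED.  `siteCount L σ r Z tB P tE e = Σ_{b ∈ P e} #zone(…, tE e − tB b, Z b)`;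
  `siteCount_le`: `N_e ≤ (κ_site · p)(1 + Σ_{b ∈ P e} d′(Z b)(1/2)^{tE e − tB b})` — literally the binder `hN` of
  `T4JointInsertionProfile.prod_sites_le_exp` with `θ = 1/2`, `w_b = d′(Z b)`, `κ = κ_site(d, r) · p` (pv14's header:
  «a TYPED shrinking site bound whose shape is NOT PRINTED (located on B16 p.384)»); `prod_siteCount_le_exp` = that
  theorem applied: `∏_{e ∈ E} N_e ≤ (κ_site p)^{#E} · exp(μ · Σ_{b ∈ B} d′(Z b))` (`θ/(1−θ) = 1`): the within-slot
  attachment entropy is a CONSTANT PER EVENT and `exp(μ · d′)` PER PIECE — the latter in the currency of the birth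
  factors (1.79), i.e. of `T4PersistentHistoryCount.birthCredit_dominates`' binder `μ`.
* §3 THE BIRTH-SHAPE ENTROPY IN d′-CURRENCY.  `shapeRate d = kappa₀(4·2^d)(2d)`, `shapeConst d = K₀(4·2^d)(2d)`
  (`B12TreeDecay`); `birthShapeSum_le` = `TreeLengthCubeSystem.sum_exp_treeLen_le` BY NAME
  (`Σ_{X ∋ c, X ⊆ B face-connected} exp(−κ d′(X)) ≤ K₀(d)` for `κ ≥ κ₀(d)`); corollaries `card_fatnessClass_le`
  (`#{shapes through c of fatness class ≤ D} ≤ K₀(d) exp(κ₀(d)(D + 1))`), `card_fatnessClass_le_exp` (the same as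
  `≤ exp(E_f(d)(D + 1))` with `E_f(d) = κ₀(d) + log K₀(d)` = `fatShapeEntropy`, `one_le_shapeConst`, `log_shapeConst`)
  — an admissible value of the binder `E_f` of `birthCredit_dominates` — and `birthResidualSum_le`
  (`Σ_{X ∋ c} exp(−a(d′(X) + 1)) ≤ exp(−a) K₀(d)` for `a ≥ κ₀(d)`) — the binder `Σ_b ρ_b ≤ ρ̄` of
  `T4PersistentHistoryCount.slotDom_of_records` when the birth kinds at an anchor cube are the shapes through it.
* §4 VOLUME ↔ TREE LENGTH (`exp_volume_le_exp_treeLen`, `exp_treeLen_le_exp_volume`): pv14's volume grading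
  (`T4InsertionProfile.gradedShapeSum_le`, `card_animals_filter_le`) and print's `d′` grading bound each other with the
  rate changed by the factor `2^{d+2}` — the two typed skeletons (pv14's joint profile, this lineage's record model) may
  be fed in either currency.
* §5 NUMBERS at `d = 4`: `κ_site(4, 1) = 65⁴·2⁷ = 2 284 880 000`, `log κ_site(4, 1) < 22`; `κ₀(4) = 64 log 162 < 327`
  (`TreeLengthCubeSystem.kappa₀_four`), `K₀(4) = 162^64/81`, `E_f(4) < 650` per unit of `d′ + 1`.

WHAT IT DOES NOT PROVE (located residuals, cell GAPS G-ne7bp1g4-1).  (ID) That the positional freedom of a RENEWAL at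
step `t` of a piece born at `s` IS a choice of cubes in `zone(…, r, t − s, Z)` (p. 384 «if no large fields are created
in a neighborhood of Z, more precisely in S(Z)\Z» read as: a renewal is a new large field inside `S(Z^{t−s})`, one layer
`r = 1` of the next iterate), and likewise for the seed of a merger-with-birth (p. 386), is the cell's READING
(`t4/T4-XREAD-NE7b-READING.md`), not print; the piece bound `p` and the multiplicity `μ` (events per piece per step) are
(ID)-ledger data of `T4PersistenceDictionary.Gen`, typed here, not instantiated; the horizon `K` of the drop control is
the run's length under (2.7b) [III].  (E2/R1) The per-record analytic PRICE — the binders `hy` of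
`T4JointInsertionProfile` / `hdom` of `T4PersistenceDictionary.slotDom_of_records_dict` — is the WALL of NE7b and is not
touched: this file bounds NUMBERS OF TERMS, never a term.  (O(1)) Print's «exp O(1)(MR_j)^{−d}|Z_j|» is per unit of
scaled VOLUME; §3 gives it per unit of `d′` through (2.30) — the same currency as the credit (1.79) — with the cell's
constants; whether Bałaban's O(1) is ≤ `E_f(d)` is not a question this cell asks (ABSOLUTE RULE: the constant used
downstream is the kernel one).
-/

namespace Literature.MathematicalPhysics.QuantumFieldTheory.Balaban1983to89.T4EntropyShapeInstances

open Literature.MathematicalPhysics.QuantumFieldTheory.Balaban1983to89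
open Literature.MathematicalPhysics.QuantumFieldTheory.Balaban1983to89.B13ScaleTransfer
open Literature.MathematicalPhysics.QuantumFieldTheory.Balaban1983to89.TreeLength
open Literature.MathematicalPhysics.QuantumFieldTheory.Balaban1983to89.B16SProfile
open Literature.MathematicalPhysics.QuantumFieldTheory.Balaban1983to89.B12TreeDecay
open Literature.MathematicalPhysics.QuantumFieldTheory.Balaban1983to89.TreeLengthCubeSystem

noncomputable section

variable {d : ℕ}

/-! ## §1 The attachment zone of an iterate and its cube count (the shrinking site bound as a theorem) -/

section Zone

/-- The `r`-layer ATTACHMENT ZONE of the `i`-th iterate: `(S^{i}(Z))^{~r} = collar^[r] (Siter q i Z)` — the cubes of the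
current scale within `r` sup-metric layers of the domain `S^{i}(Z)` (`r = 0`: the domain itself; `r = 1`: the cubes meeting or
touching it).  Cell bookkeeping on the index model of `…B16SProfile`, NOT a printed notion. [folklore] -/
def zone (q : ℕ → ℕ) (r i : ℕ) (Z : Finset (Pt d)) : Finset (Pt d) := collar^[r] (Siter q i Z)

/-- The domain lies in its zone. [folklore] -/
theorem Siter_subset_zone (q : ℕ → ℕ) (r i : ℕ) (Z : Finset (Pt d)) : Siter q i Z ⊆ zone q r i Z :=
  subset_iterate_collar r _

/-- `r = 0`: the zone is the domain. [folklore] -/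
@[simp] theorem zone_zero (q : ℕ → ℕ) (i : ℕ) (Z : Finset (Pt d)) : zone q 0 i Z = Siter q i Z := rfl

/-- The zone of a non-empty set is non-empty. [folklore] -/
theorem zone_nonempty (q : ℕ → ℕ) (r i : ℕ) {Z : Finset (Pt d)} (hZ : Z.Nonempty) : (zone q r i Z).Nonempty :=
  (Siter_nonempty q hZ i).mono (Siter_subset_zone q r i Z)

/-- **THE ZONE LIES IN THE `(31 + r)`-BOXES AROUND THE COVER** — print's «S^{n−j}(Z) ⊂ ⋃_{□₀⊂Z^{(n−j)}} □₀^{∼31}» (p. 384)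
with `r` more layers: `(S^{i}(Z))^{~r} ⊆ ⋃_{c ∈ Z^{(i)}} box c (31 + r)` (`L ≥ 3`, two-sided drop control, `i ≤ m`).
(`B16SProfile.Siter_subset_biUnion_box` + layers of boxes are boxes.) [cite: Balaban1989LargeFieldII, p.384 (display after (1.80))] -/
theorem zone_subset_biUnion_box {L : ℕ} {σ : ℕ → ℕ} {m i : ℕ} (hL : 3 ≤ L) (h : DropCtl σ m)
    (Z : Finset (Pt d)) (hi : i ≤ m) (r : ℕ) :
    zone (ratio L σ) r i Z ⊆ (closureIdx (Qprod (ratio L σ) i) Z).biUnion fun c => box c (31 + r) := by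
  unfold zone
  refine (iterate_collar_mono r (Siter_subset_biUnion_box hL h Z hi)).trans ?_
  rw [iterate_collar_biUnion]
  exact Finset.biUnion_mono fun c _ => iterate_collar_box_subset c 31 r

/-- **CUBE COUNT OF THE ZONE BY THE COVER**: `|(S^{i}(Z))^{~r}| ≤ (63 + 2r)^d · |Z^{(i)}|` — print's
«(63)^d (MR_n)^{−d}|Z^{(n−j)}|» (p. 384) with `r` more layers (`r = 0` is `B16SProfile.card_Siter_le`).
[cite: Balaban1989LargeFieldII, p.384 (display after (1.80))] -/
theorem card_zone_le_cover {L : ℕ} {σ : ℕ → ℕ} {m i : ℕ} (hL : 3 ≤ L) (h : DropCtl σ m)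
    (Z : Finset (Pt d)) (hi : i ≤ m) (r : ℕ) :
    (zone (ratio L σ) r i Z).card ≤ (63 + 2 * r) ^ d * (closureIdx (Qprod (ratio L σ) i) Z).card := by
  refine (Finset.card_le_card (zone_subset_biUnion_box hL h Z hi r)).trans (Finset.card_biUnion_le.trans ?_)
  simp only [card_box, Finset.sum_const, smul_eq_mul]
  rw [show 2 * (31 + r) + 1 = 63 + 2 * r by ring, mul_comm]

/-- **THE COVER'S CUBE COUNT BY ITS TREE LENGTH** (the cell's REPAIRED lower half of (2.30), `TreeLength.card_le_treeLen`,
in place of print's «≤ 3·2^{d−1} d′_n(Z^{(n−j)})» / «(64)^d», p. 384): `|Z^{(i)}| ≤ 2^d (4 d′(Z^{(i)}) + 1)` for a non-empty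
face-connected `Z`. [cite: Balaban1989LargeFieldII, p.384 (display after (1.80))] -/
theorem card_cover_le {L : ℕ} (hL : 0 < L) (σ : ℕ → ℕ) {Z : Finset (Pt d)} (hZ : Z.Nonempty)
    (hZc : FaceConnected Z) (i : ℕ) :
    ((closureIdx (Qprod (ratio L σ) i) Z).card : ℝ) ≤
      2 ^ d * (4 * treeLen (closureIdx (Qprod (ratio L σ) i) Z) + 1) :=
  card_le_treeLen (closureIdx_nonempty hZ) (faceConnected_closureIdx (Qprod_pos (ratio_pos hL σ) i) hZc)

/-- **SHRINKING OF THE COVER'S TREE LENGTH, EVERY STEP**: `d′(Z^{(i)}) ≤ 2 · (1/2)^i · d′(Z)` for ALL `0 ≤ i ≤ m`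
(`L ≥ 4`, drop control) — `B16SProfile.half_pow_mul_treeLen_ge` («d′_n(Z^{(n−j)}) ≤ 2^{−(n−j)}d′_j(Z)» p. 384 «for
n − j > 1» p. 385, and `d′(Z^{(1)}) ≤ d′(Z)`) with the first two steps absorbed in the factor `2`.
[cite: Balaban1989LargeFieldII, p.384 last display] -/
theorem treeLen_cover_le {L : ℕ} {σ : ℕ → ℕ} {m i : ℕ} (hL : 4 ≤ L) (h : DropCtl σ m)
    {Z : Finset (Pt d)} (hZ : Z.Nonempty) (hZc : FaceConnected Z) (hi : i ≤ m) :
    treeLen (closureIdx (Qprod (ratio L σ) i) Z) ≤ 2 * (1 / 2 : ℝ) ^ i * treeLen Z := by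
  rcases Nat.eq_zero_or_pos i with rfl | hi1
  · rw [Qprod_zero, closureIdx_one, pow_zero]
    linarith [treeLen_nonneg Z]
  · have h1 := half_pow_mul_treeLen_ge hL h hZ hZc hi1 hi
    linarith

/-- THE SITE CONSTANT `κ_site(d, r) = (63 + 2r)^d · 2^{d+3}` — per event and per piece, dimension-only (the cell's value
standing in for print's «(63)^d 3·2^{d−1}» of p. 384; NOT a printed constant). [folklore] -/
def siteConst (d r : ℕ) : ℝ := (63 + 2 * r) ^ d * 2 ^ (d + 3)

/-- `κ_site ≥ 1`. [folklore] -/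
theorem one_le_siteConst (d r : ℕ) : 1 ≤ siteConst d r := by
  unfold siteConst
  exact one_le_mul_of_one_le_of_one_le (one_le_pow₀ (by linarith [(Nat.cast_nonneg r : (0 : ℝ) ≤ r)]))
    (one_le_pow₀ (by norm_num))

/-- `κ_site ≥ 0`. [folklore] -/
theorem siteConst_nonneg (d r : ℕ) : 0 ≤ siteConst d r := le_trans zero_le_one (one_le_siteConst d r)

/-- **THE SHRINKING SITE BOUND AS A THEOREM OF THE INDEX MODEL.**  For `L ≥ 4`, an exponent sequence under the two-sided
drop control on `[0, m]` (`B16SProfile.DropCtl`, from (2.7b)/(2.9) by `B16SProfile.dropCtl_of_27b`), a non-empty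
face-connected creation-scale region `Z` and every later step `i ≤ m`: the number of current-scale cubes within `r` layers
of the iterate `S^{i}(Z)` is at most `κ_site(d, r) · (1 + d′(Z) · (1/2)^i)` — a CONSTANT plus a GEOMETRICALLY SHRUNK multiple
of the birth size.  This is the TYPE `N_e ≤ κ · (1 + Σ_b w_b · θ^{t_e − t_b})` of the site-count HYPOTHESIS of
`T4JointInsertionProfile.prod_sites_le_exp` (pv14: «a TYPED shrinking site bound whose shape is NOT PRINTED (located on B16
p. 384)») for ONE piece, with `θ = 1/2`, `w_b = d′(Z_b)` = `treeLen`, `κ = κ_site`.  Chain: `card_zone_le_cover`,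
`card_cover_le`, `treeLen_cover_le`. [cite: Balaban1989LargeFieldII, p.384 (display after (1.80)) and last display] -/
theorem card_zone_le {L : ℕ} {σ : ℕ → ℕ} {m i : ℕ} (hL : 4 ≤ L) (h : DropCtl σ m)
    {Z : Finset (Pt d)} (hZ : Z.Nonempty) (hZc : FaceConnected Z) (hi : i ≤ m) (r : ℕ) :
    ((zone (ratio L σ) r i Z).card : ℝ) ≤ siteConst d r * (1 + treeLen Z * (1 / 2 : ℝ) ^ i) := by
  have hL3 : 3 ≤ L := by omega
  have hL0 : 0 < L := by omega
  have h1 : ((zone (ratio L σ) r i Z).card : ℝ) ≤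
      (63 + 2 * r) ^ d * ((closureIdx (Qprod (ratio L σ) i) Z).card : ℝ) := by
    exact_mod_cast card_zone_le_cover hL3 h Z hi r
  have h2 := card_cover_le hL0 σ hZ hZc i
  have h3 := treeLen_cover_le hL h hZ hZc hi
  have h63 : (0 : ℝ) ≤ (63 + 2 * r) ^ d := by positivity
  have h2d : (0 : ℝ) ≤ 2 ^ d := by positivity
  have ht := treeLen_nonneg Z
  have hh : (0 : ℝ) ≤ (1 / 2 : ℝ) ^ i := by positivity
  have h4 : 2 ^ d * (4 * treeLen (closureIdx (Qprod (ratio L σ) i) Z) + 1) ≤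
      2 ^ (d + 3) * (1 + treeLen Z * (1 / 2 : ℝ) ^ i) := by
    rw [pow_add]
    nlinarith [mul_nonneg h2d (mul_nonneg ht hh), mul_le_mul_of_nonneg_left h3 h2d]
  unfold siteConst
  calc ((zone (ratio L σ) r i Z).card : ℝ)
      ≤ (63 + 2 * r) ^ d * ((closureIdx (Qprod (ratio L σ) i) Z).card : ℝ) := h1
    _ ≤ (63 + 2 * r) ^ d * (2 ^ d * (4 * treeLen (closureIdx (Qprod (ratio L σ) i) Z) + 1)) :=
        mul_le_mul_of_nonneg_left h2 h63
    _ ≤ (63 + 2 * r) ^ d * (2 ^ (d + 3) * (1 + treeLen Z * (1 / 2 : ℝ) ^ i)) :=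
        mul_le_mul_of_nonneg_left h4 h63
    _ = (63 + 2 * r) ^ d * 2 ^ (d + 3) * (1 + treeLen Z * (1 / 2 : ℝ) ^ i) := by ring

/-- The same bound along a run with an ABSOLUTE drop control on `[0, K]`, for a region born at step `s` and seen at step
`t` (`s ≤ t ≤ K`): the ratio sequence of the region's own life is the shifted one `ratio L (fun n => σ (s + n))`
(`= fun i => ratio L σ (s + i)`, `B16MergeHorizon.ratio_shift_fun`; its iterates are the absolute-step iterates restarted
at `s`, `B16MergeHorizon.Siter_add`), under the shifted drop control `B16SProfile.dropCtl_shift`. [folklore] -/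
theorem card_zone_shift_le {L : ℕ} (hL : 4 ≤ L) {σ : ℕ → ℕ} {K : ℕ} (hdrop : DropCtl σ K)
    {Z : Finset (Pt d)} (hZ : Z.Nonempty) (hZc : FaceConnected Z) {s t : ℕ} (hst : s ≤ t) (htK : t ≤ K) (r : ℕ) :
    ((zone (ratio L (fun n => σ (s + n))) r (t - s) Z).card : ℝ) ≤
      siteConst d r * (1 + treeLen Z * (1 / 2 : ℝ) ^ (t - s)) :=
  card_zone_le hL (dropCtl_shift (j := s) hdrop) hZ hZc (by omega) r

end Zone

/-! ## §2 The site-count hypothesis of `T4JointInsertionProfile.prod_sites_le_exp`, DISCHARGED on the index model -/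

section Sites

variable {ε β : Type*}

/-- THE SITE COUNT OF AN EVENT on the index model: event `e` at step `tE e` attaches to the strictly older pieces `b ∈ P e`
(regions `Z b` born at steps `tB b`) inside the `r`-layer zones of their iterates `S^{tE e − tB b}(Z b)`; its number of
attachment sites is (at most) the total cube count of those zones.  That THIS is the positional freedom of a renewal
(p. 384 «Such a domain arises as a new large field region in our procedure, if no large fields are created in a neighborhood
of Z, more precisely in S(Z)\Z») / of a merger-with-birth (p. 386) is the cell's READING (ID) (record
`t4/T4-XREAD-NE7b-READING.md`), NOT print; a merger of two old pieces alone has no positional freedom. [folklore] -/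
def siteCount (L : ℕ) (σ : ℕ → ℕ) (r : ℕ) (Z : β → Finset (Pt d)) (tB : β → ℕ) (P : ε → Finset β)
    (tE : ε → ℕ) (e : ε) : ℝ :=
  ∑ b ∈ P e, ((zone (ratio L (fun n => σ (tB b + n))) r (tE e - tB b) (Z b)).card : ℝ)

/-- Site counts are non-negative. [folklore] -/
theorem siteCount_nonneg (L : ℕ) (σ : ℕ → ℕ) (r : ℕ) (Z : β → Finset (Pt d)) (tB : β → ℕ) (P : ε → Finset β)
    (tE : ε → ℕ) (e : ε) : 0 ≤ siteCount L σ r Z tB P tE e :=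
  Finset.sum_nonneg fun _ _ => Nat.cast_nonneg _

/-- **THE TYPED SITE BOUND `hN` HOLDS ON THE INDEX MODEL**: with `θ = 1/2`, `w_b = d′(Z b)` and `κ = κ_site(d, r) · p`
(`p ≥ 1` a bound on the number of pieces one event touches): `N_e ≤ κ · (1 + Σ_{b ∈ P e} w_b θ^{tE e − tB b})` for every
event of a run with `L ≥ 4` and the drop control on `[0, K]`. [folklore] -/
theorem siteCount_le {L : ℕ} (hL : 4 ≤ L) {σ : ℕ → ℕ} {K : ℕ} (hdrop : DropCtl σ K) (r : ℕ)
    (E : Finset ε) (B : Finset β) (Z : β → Finset (Pt d)) (tB : β → ℕ) (P : ε → Finset β) (tE : ε → ℕ)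
    {p : ℕ} (hp : 1 ≤ p) (hPB : ∀ e ∈ E, P e ⊆ B) (hZ : ∀ b ∈ B, (Z b).Nonempty)
    (hZc : ∀ b ∈ B, FaceConnected (Z b)) (hlt : ∀ e ∈ E, ∀ b ∈ P e, tB b < tE e)
    (htE : ∀ e ∈ E, tE e ≤ K) (hP : ∀ e ∈ E, (P e).card ≤ p) :
    ∀ e ∈ E, siteCount L σ r Z tB P tE e ≤
      siteConst d r * p * (1 + ∑ b ∈ P e, treeLen (Z b) * (1 / 2 : ℝ) ^ (tE e - tB b)) := by
  intro e he
  have hκ := siteConst_nonneg d r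
  have hx0 : 0 ≤ ∑ b ∈ P e, treeLen (Z b) * (1 / 2 : ℝ) ^ (tE e - tB b) :=
    Finset.sum_nonneg fun b _ => mul_nonneg (treeLen_nonneg _) (by positivity)
  have hcard : ((P e).card : ℝ) ≤ p := by exact_mod_cast hP e he
  have hp1 : (1 : ℝ) ≤ p := by exact_mod_cast hp
  calc siteCount L σ r Z tB P tE e
      ≤ ∑ b ∈ P e, siteConst d r * (1 + treeLen (Z b) * (1 / 2 : ℝ) ^ (tE e - tB b)) :=
        Finset.sum_le_sum fun b hb => card_zone_shift_le hL hdrop (hZ b (hPB e he hb)) (hZc b (hPB e he hb))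
          (hlt e he b hb).le (htE e he) r
    _ = siteConst d r * (P e).card + siteConst d r * ∑ b ∈ P e, treeLen (Z b) * (1 / 2 : ℝ) ^ (tE e - tB b) := by
        rw [← Finset.mul_sum, Finset.sum_add_distrib, Finset.sum_const, nsmul_eq_mul, mul_one, mul_add]
    _ ≤ siteConst d r * p + siteConst d r * p * ∑ b ∈ P e, treeLen (Z b) * (1 / 2 : ℝ) ^ (tE e - tB b) := by
        nlinarith [mul_nonneg hκ hx0]
    _ = siteConst d r * p * (1 + ∑ b ∈ P e, treeLen (Z b) * (1 / 2 : ℝ) ^ (tE e - tB b)) := by ring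

/-- **THE WITHIN-SLOT ATTACHMENT ENTROPY ON THE INDEX MODEL** (`T4JointInsertionProfile.prod_sites_le_exp` with its site
hypothesis `hN` DISCHARGED by `siteCount_le`, `θ = 1/2` so `θ/(1 − θ) = 1`): for a structure with pieces `b ∈ B` (non-empty
face-connected index-model regions `Z b` born at `tB b`) and events `e ∈ E` at steps `tE e ≤ K` attaching to strictly older
pieces `P e ⊆ B`, at most `p` pieces per event and at most `μ` events per piece per step:
`∏_{e ∈ E} N_e ≤ (κ_site(d, r) · p)^{#E} · exp(μ · Σ_{b ∈ B} d′(Z b))` — a constant PER EVENT and an exponential in the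
TOTAL TREE LENGTH of the pieces (print's currency `d′`, (1.79) p. 383), the latter to be paid by the birth factors
«exp(−½γ₀A₁²p₀²(g_j)(d′_j(Z_j^{(i)}) + 1) …)» ((1.79); `T4PersistentHistoryCount.birthCredit_dominates`, binder `μ`).
The multiplicity `μ` and the piece bound `p` are (ID)-ledger data, not instantiated here. [cite: Balaban1989LargeFieldII, p.384 (display after (1.80)) and last display] -/
theorem prod_siteCount_le_exp [DecidableEq β] {L : ℕ} (hL : 4 ≤ L) {σ : ℕ → ℕ} {K : ℕ} (hdrop : DropCtl σ K)
    (r : ℕ) (E : Finset ε) (B : Finset β) (Z : β → Finset (Pt d)) (tB : β → ℕ) (P : ε → Finset β) (tE : ε → ℕ)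
    {p μ : ℕ} (hp : 1 ≤ p) (hPB : ∀ e ∈ E, P e ⊆ B) (hZ : ∀ b ∈ B, (Z b).Nonempty)
    (hZc : ∀ b ∈ B, FaceConnected (Z b)) (hlt : ∀ e ∈ E, ∀ b ∈ P e, tB b < tE e)
    (htE : ∀ e ∈ E, tE e ≤ K) (hP : ∀ e ∈ E, (P e).card ≤ p)
    (hμ : ∀ b ∈ B, ∀ t : ℕ, (E.filter fun e => b ∈ P e ∧ tE e = t).card ≤ μ) :
    ∏ e ∈ E, siteCount L σ r Z tB P tE e ≤
      (siteConst d r * p) ^ E.card * Real.exp ((μ : ℝ) * ∑ b ∈ B, treeLen (Z b)) := by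
  have hκ : 0 ≤ siteConst d r * p := mul_nonneg (siteConst_nonneg d r) (Nat.cast_nonneg p)
  have h := T4JointInsertionProfile.prod_sites_le_exp (θ := 1 / 2) (κ := siteConst d r * p)
    (by norm_num) (by norm_num) hκ E B tE tB P (fun b => treeLen (Z b)) (siteCount L σ r Z tB P tE)
    hPB (fun b _ => treeLen_nonneg _) hlt hμ (fun e _ => siteCount_nonneg L σ r Z tB P tE e)
    (siteCount_le hL hdrop r E B Z tB P tE hp hPB hZ hZc hlt htE hP)
  have e1 : ((1 : ℝ) / 2) / (1 - 1 / 2) = 1 := by norm_num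
  simpa only [e1, mul_one] using h

end Sites

/-! ## §3 The birth-shape entropy in tree-length currency (`TreeLengthCubeSystem.sum_exp_treeLen_le` BY NAME) -/

section Birth

/-- THE SHAPE RATE `κ₀(d) = kappa₀(4·2^d, 2d)` and THE SHAPE CONSTANT `K₀(d) = K₀(4·2^d, 2d)` of the tree's lattice-animal
theorem in tree-length currency ([Balaban1988RG2Cluster] (1.26) for `treeLen`, `TreeLengthCubeSystem.sum_exp_treeLen_le`;
constants of `B12TreeDecay`, dimension-only). [folklore] -/
def shapeRate (d : ℕ) : ℝ := kappa₀ (4 * 2 ^ d) (2 * d)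

/-- See `shapeRate`. [folklore] -/
def shapeConst (d : ℕ) : ℝ := K₀ (4 * 2 ^ d) (2 * d)

/-- `κ₀(d) ≥ 0`. [folklore] -/
theorem shapeRate_nonneg (d : ℕ) : 0 ≤ shapeRate d := kappa₀_nonneg (by positivity) _

/-- `K₀(d) > 0`. [folklore] -/
theorem shapeConst_pos (d : ℕ) : 0 < shapeConst d := K₀_pos _ _

/-- **THE BIRTH-SHAPE ENTROPY IN d′-CURRENCY IS A THEOREM** (restated BY NAME): inside any finite window `B ⊆ ℤᵈ` of
creation-scale cubes and for any anchor cube `c ∈ B`, `Σ_{X ⊆ B face-connected, X ∋ c} exp(−κ · d′(X)) ≤ K₀(d)` for every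
`κ ≥ κ₀(d)` — the count of the possible SHAPES of a new large-field component through a given cube, weighted by its tree
length: print's «the summations over the admissible sequences can be replaced by the factors exp O(1)(MR_j)^{−d}|Z_j|»
(p. 383) in the currency `d′` of (1.79), as the tree's (1.26)-for-`treeLen`. [cite: Balaban1989LargeFieldII, p.383 (sentence before (1.79))] -/
theorem birthShapeSum_le (B : Finset (Pt d)) {c : Pt d} (hc : c ∈ B) {κ : ℝ} (hκ : shapeRate d ≤ κ)
    [DecidablePred fun X : Finset (Pt d) => c ∈ X ∧ FaceConnected X] :
    ∑ X ∈ B.powerset.filter (fun X => c ∈ X ∧ FaceConnected X), Real.exp (-κ * treeLen X) ≤ shapeConst d :=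
  sum_exp_treeLen_le B hc hκ

/-- **THE FATNESS-CLASS COUNT** (the `e^{E_f (d′ + 1)}` of `T4PersistentHistoryCount.birthCredit_dominates`' fat-shape
entropy, instantiated): any family `S` of face-connected shapes through `c` inside the window, all of tree length
`< D + 1` (fatness class at most `D`), has at most `K₀(d) · exp(κ₀(d) · (D + 1))` members. [folklore] -/
theorem card_fatnessClass_le (B : Finset (Pt d)) {c : Pt d} (hc : c ∈ B)
    [DecidablePred fun X : Finset (Pt d) => c ∈ X ∧ FaceConnected X]
    (S : Finset (Finset (Pt d))) (hS : S ⊆ B.powerset.filter (fun X => c ∈ X ∧ FaceConnected X))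
    (D : ℕ) (hD : ∀ X ∈ S, treeLen X < (D : ℝ) + 1) :
    (S.card : ℝ) ≤ shapeConst d * Real.exp (shapeRate d * ((D : ℝ) + 1)) := by
  have hκ := shapeRate_nonneg d
  have h1 : (S.card : ℝ) * Real.exp (-shapeRate d * ((D : ℝ) + 1)) ≤
      ∑ X ∈ S, Real.exp (-shapeRate d * treeLen X) := by
    rw [← nsmul_eq_mul, ← Finset.sum_const]
    refine Finset.sum_le_sum fun X hX => Real.exp_le_exp.2 ?_
    have := hD X hX
    nlinarith
  have h2 : ∑ X ∈ S, Real.exp (-shapeRate d * treeLen X) ≤ shapeConst d :=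
    (Finset.sum_le_sum_of_subset_of_nonneg hS fun _ _ _ => (Real.exp_pos _).le).trans
      (birthShapeSum_le B hc le_rfl)
  have h3 : Real.exp (-shapeRate d * ((D : ℝ) + 1)) * Real.exp (shapeRate d * ((D : ℝ) + 1)) = 1 := by
    rw [← Real.exp_add]; simp
  calc (S.card : ℝ) = (S.card : ℝ) * Real.exp (-shapeRate d * ((D : ℝ) + 1)) *
        Real.exp (shapeRate d * ((D : ℝ) + 1)) := by rw [mul_assoc, h3, mul_one]
    _ ≤ shapeConst d * Real.exp (shapeRate d * ((D : ℝ) + 1)) :=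
        mul_le_mul_of_nonneg_right (h1.trans h2) (Real.exp_pos _).le

/-- **THE SUMMED BIRTH RESIDUAL** (the binder `Σ_b ρ_b ≤ ρ̄` of `T4PersistentHistoryCount.slotDom_of_records` when the birth
kinds at an anchor cube are the SHAPES through it, each priced `exp(−a · (d′ + 1))` after its own credit): for a residual
rate `a ≥ κ₀(d)` per unit of `d′ + 1`, `Σ_{X ∋ c} exp(−a (d′(X) + 1)) ≤ exp(−a) · K₀(d)` — summable uniformly in the window,
and small when `a` is large (compare the fatness-class form `T4PersistentHistoryCount.sum_exp_neg_succ_le`). [folklore] -/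
theorem birthResidualSum_le (B : Finset (Pt d)) {c : Pt d} (hc : c ∈ B) {a : ℝ} (ha : shapeRate d ≤ a)
    [DecidablePred fun X : Finset (Pt d) => c ∈ X ∧ FaceConnected X] :
    ∑ X ∈ B.powerset.filter (fun X => c ∈ X ∧ FaceConnected X), Real.exp (-(a * (treeLen X + 1))) ≤
      Real.exp (-a) * shapeConst d := by
  have h1 : ∀ X ∈ B.powerset.filter (fun X => c ∈ X ∧ FaceConnected X),
      Real.exp (-(a * (treeLen X + 1))) ≤ Real.exp (-a) * Real.exp (-shapeRate d * treeLen X) := by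
    intro X _
    rw [← Real.exp_add]
    refine Real.exp_le_exp.2 ?_
    have ht := treeLen_nonneg X
    nlinarith
  calc ∑ X ∈ B.powerset.filter (fun X => c ∈ X ∧ FaceConnected X), Real.exp (-(a * (treeLen X + 1)))
      ≤ ∑ X ∈ B.powerset.filter (fun X => c ∈ X ∧ FaceConnected X),
          Real.exp (-a) * Real.exp (-shapeRate d * treeLen X) := Finset.sum_le_sum h1
    _ = Real.exp (-a) * ∑ X ∈ B.powerset.filter (fun X => c ∈ X ∧ FaceConnected X),
          Real.exp (-shapeRate d * treeLen X) := by rw [Finset.mul_sum]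
    _ ≤ Real.exp (-a) * shapeConst d :=
        mul_le_mul_of_nonneg_left (birthShapeSum_le B hc le_rfl) (Real.exp_pos _).le

/-- `K₀(d) ≥ 1` (indeed `K₀ = (2(2d+1)²)^{4·2^d} / (2d+1)² ≥ 2`). [folklore] -/
theorem one_le_shapeConst (d : ℕ) : 1 ≤ shapeConst d := by
  unfold shapeConst K₀ kappa₀
  have hΔ : (0 : ℝ) < ((2 * d : ℕ) : ℝ) + 1 := by positivity
  have hsq : (0 : ℝ) < (((2 * d : ℕ) : ℝ) + 1) ^ 2 := by positivity
  have ha : Real.exp (a₀ (2 * d)) = 2 * (((2 * d : ℕ) : ℝ) + 1) ^ 2 := by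
    unfold a₀; exact Real.exp_log (by positivity)
  have hc : (1 : ℝ) ≤ 4 * 2 ^ d := by
    have : (1 : ℝ) ≤ 2 ^ d := one_le_pow₀ (by norm_num)
    linarith
  have h1 : Real.exp (a₀ (2 * d)) ≤ Real.exp (4 * 2 ^ d * a₀ (2 * d)) :=
    Real.exp_le_exp.2 (le_mul_of_one_le_left (a₀_nonneg _) hc)
  rw [le_div_iff₀ hsq]
  linarith

/-- `log K₀(d) = κ₀(d) − 2 log(2d + 1)`. [folklore] -/
theorem log_shapeConst (d : ℕ) : Real.log (shapeConst d) = shapeRate d - 2 * Real.log (2 * (d : ℝ) + 1) := by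
  unfold shapeConst shapeRate K₀
  have hΔ : (0 : ℝ) < ((2 * d : ℕ) : ℝ) + 1 := by positivity
  rw [Real.log_div (Real.exp_pos _).ne' (by positivity), Real.log_exp, Real.log_pow]
  push_cast
  ring

/-- THE FAT-SHAPE ENTROPY PER UNIT OF `d′ + 1`: `E_f(d) = κ₀(d) + log K₀(d)` — an admissible value of the binder `E_f` of
`T4PersistentHistoryCount.birthCredit_dominates` (by `card_fatnessClass_le_exp`), dimension-only. [folklore] -/
def fatShapeEntropy (d : ℕ) : ℝ := shapeRate d + Real.log (shapeConst d)

/-- `E_f(d) ≥ 0`. [folklore] -/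
theorem fatShapeEntropy_nonneg (d : ℕ) : 0 ≤ fatShapeEntropy d :=
  add_nonneg (shapeRate_nonneg d) (Real.log_nonneg (one_le_shapeConst d))

/-- **THE FATNESS-CLASS COUNT IN THE BINDER'S SHAPE**: `#(shapes through c of fatness class ≤ D) ≤ exp(E_f(d) · (D + 1))`.
[folklore] -/
theorem card_fatnessClass_le_exp (B : Finset (Pt d)) {c : Pt d} (hc : c ∈ B)
    [DecidablePred fun X : Finset (Pt d) => c ∈ X ∧ FaceConnected X]
    (S : Finset (Finset (Pt d))) (hS : S ⊆ B.powerset.filter (fun X => c ∈ X ∧ FaceConnected X))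
    (D : ℕ) (hD : ∀ X ∈ S, treeLen X < (D : ℝ) + 1) :
    (S.card : ℝ) ≤ Real.exp (fatShapeEntropy d * ((D : ℝ) + 1)) := by
  have h1 := card_fatnessClass_le B hc S hS D hD
  have hK := one_le_shapeConst d
  have hlog : 0 ≤ Real.log (shapeConst d) := Real.log_nonneg hK
  have hD0 : (0 : ℝ) ≤ D := Nat.cast_nonneg D
  have h2 : shapeConst d * Real.exp (shapeRate d * ((D : ℝ) + 1)) ≤ Real.exp (fatShapeEntropy d * ((D : ℝ) + 1)) := by
    rw [← Real.exp_log (lt_of_lt_of_le zero_lt_one hK), ← Real.exp_add]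
    refine Real.exp_le_exp.2 ?_
    unfold fatShapeEntropy
    nlinarith
  exact h1.trans h2

end Birth

/-! ## §4 Volume ↔ tree length: the two gradings are interchangeable -/

section Grading

/-- **VOLUME PRICE ≤ TREE-LENGTH PRICE**: for a non-empty face-connected region, `d′(Z) + 1 ≤ |Z|`
(`TreeLength.treeLen_le_card_sub_one`), so a per-CUBE decay `exp(−a |Z|)` (the volume grading `C^w`, `λ^{v s}` of
`T4InsertionProfile.gradedShapeSum_le`) is at most the per-unit-`d′` decay `exp(−a (d′(Z) + 1))`. [folklore] -/
theorem exp_volume_le_exp_treeLen {Z : Finset (Pt d)} (hZ : Z.Nonempty) (hZc : FaceConnected Z) {a : ℝ}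
    (ha : 0 ≤ a) : Real.exp (-(a * Z.card)) ≤ Real.exp (-(a * (treeLen Z + 1))) := by
  refine Real.exp_le_exp.2 ?_
  have h := treeLen_le_card_sub_one hZ hZc
  nlinarith

/-- **TREE-LENGTH PRICE ≤ VOLUME PRICE AT RATE `a / 2^{d+2}`**: `|Z| ≤ 2^d (4 d′(Z) + 1)` (`TreeLength.card_le_treeLen`),
so `exp(−a · 2^d(4 d′(Z) + 1)) ≤ exp(−a |Z|)`: a decay per unit of tree length at rate `2^{d+2} a` dominates the per-cube
decay at rate `a`. [folklore] -/
theorem exp_treeLen_le_exp_volume {Z : Finset (Pt d)} (hZ : Z.Nonempty) (hZc : FaceConnected Z) {a : ℝ}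
    (ha : 0 ≤ a) : Real.exp (-(a * (2 ^ d * (4 * treeLen Z + 1)))) ≤ Real.exp (-(a * Z.card)) := by
  refine Real.exp_le_exp.2 ?_
  have h := card_le_treeLen hZ hZc
  nlinarith

end Grading

/-! ## §5 Numerical values at `d = 4` -/

section Numbers

/-- The site constant at `d = 4`, `r = 1` (cubes touching the domain): `65^4 · 2^7 = 2 284 880 000`. [folklore] -/
theorem siteConst_four_one : siteConst 4 1 = 2284880000 := by
  unfold siteConst; norm_num

/-- … and at `r = 0` (the domain itself): `63^4 · 2^7 = 2 016 379 008`. [folklore] -/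
theorem siteConst_four_zero : siteConst 4 0 = 2016379008 := by
  unfold siteConst; norm_num

/-- Its logarithm — the per-event, per-piece site entropy — is below `22`. [folklore] -/
theorem log_siteConst_four_one_lt : Real.log (siteConst 4 1) < 22 := by
  rw [siteConst_four_one]
  have h1 := Real.exp_one_gt_d9
  have h2 : (2284880000 : ℝ) < Real.exp 22 := by
    calc (2284880000 : ℝ) < (2.7182818283 : ℝ) ^ 22 := by norm_num
      _ < (Real.exp 1) ^ 22 := pow_lt_pow_left₀ h1 (by norm_num) (by norm_num)
      _ = Real.exp 22 := by rw [← Real.exp_nat_mul]; norm_num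
  exact (Real.log_lt_iff_lt_exp (by norm_num)).2 h2

/-- The shape rate at `d = 4`: `κ₀(4) = 64 · log 162` (`TreeLengthCubeSystem.kappa₀_four`), below `327` per unit of tree
length. [folklore] -/
theorem shapeRate_four_lt : shapeRate 4 = 64 * Real.log 162 ∧ shapeRate 4 < 327 := by
  have h0 : shapeRate 4 = 64 * Real.log 162 := kappa₀_four
  refine ⟨h0, ?_⟩
  rw [h0]
  have h1 := Real.exp_one_gt_d9
  have h2 : (162 : ℝ) < Real.exp (327 / 64) := by
    have e1 : Real.exp (327 / 64) = Real.exp 5 * Real.exp (7 / 64) := by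
      rw [← Real.exp_add]; norm_num
    have h5 : (2.7182818283 : ℝ) ^ 5 < Real.exp 5 := by
      calc (2.7182818283 : ℝ) ^ 5 < (Real.exp 1) ^ 5 := pow_lt_pow_left₀ h1 (by norm_num) (by norm_num)
        _ = Real.exp 5 := by rw [← Real.exp_nat_mul]; norm_num
    have h7 : (1 : ℝ) + 7 / 64 ≤ Real.exp (7 / 64) := by
      have := Real.add_one_le_exp (7 / 64 : ℝ)
      linarith
    rw [e1]
    calc (162 : ℝ) < (2.7182818283 : ℝ) ^ 5 * (1 + 7 / 64) := by norm_num
      _ ≤ Real.exp 5 * Real.exp (7 / 64) :=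
          mul_le_mul h5.le h7 (by norm_num) (Real.exp_pos _).le
  have h3 : Real.log 162 < 327 / 64 := (Real.log_lt_iff_lt_exp (by norm_num)).2 h2
  linarith

/-- The shape constant at `d = 4`: `K₀(4) = 162^64 / 81`. [folklore] -/
theorem shapeConst_four : shapeConst 4 = 162 ^ 64 / 81 := by
  have h0 : kappa₀ (4 * 2 ^ 4) (2 * 4) = 64 * Real.log 162 := kappa₀_four
  unfold shapeConst K₀
  rw [h0, show (64 : ℝ) * Real.log 162 = ((64 : ℕ) : ℝ) * Real.log 162 by norm_num, Real.exp_nat_mul,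
    Real.exp_log (by norm_num)]
  norm_num

/-- The fat-shape entropy at `d = 4`: `E_f(4) = 128 log 162 − 2 log 9 < 650` per unit of `d′ + 1`. [folklore] -/
theorem fatShapeEntropy_four_lt : fatShapeEntropy 4 < 650 := by
  have h := shapeRate_four_lt
  have hl : fatShapeEntropy 4 = 2 * shapeRate 4 - 2 * Real.log (2 * (4 : ℕ) + 1 : ℝ) := by
    unfold fatShapeEntropy; rw [log_shapeConst]; ring
  have h9 : (2 : ℝ) < Real.log (2 * (4 : ℕ) + 1 : ℝ) := by
    have h1 := Real.exp_one_lt_d9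
    have h2 : Real.exp 2 < (2 * (4 : ℕ) + 1 : ℝ) := by
      calc Real.exp 2 = (Real.exp 1) ^ 2 := by rw [← Real.exp_nat_mul]; norm_num
        _ < (2.7182818286 : ℝ) ^ 2 := pow_lt_pow_left₀ h1 (Real.exp_pos _).le (by norm_num)
        _ < (2 * (4 : ℕ) + 1 : ℝ) := by norm_num
    exact (Real.lt_log_iff_exp_lt (by norm_num)).2 h2
  rw [hl]
  linarith [h.2]

end Numbers

end

end Literature.MathematicalPhysics.QuantumFieldTheory.Balaban1983to89.T4EntropyShapeInstances
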